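import Summits.QuantumFields.BalabanUV.InfraRed.StrongCouplingSixFifthsMoments

/-!
# `InfraRed.StrongCouplingSixFifthsVariance` — the `SU(2)` one-link variance lemma up to tilt `|2 Re tr(g B)| ≤ 6/5`
# (lineage IR-SC, certificate J-SC11 part 2 of 3; cell `pub-balaban`)

HONEST FRAMING (verbatim, binding): «observatory of the non-perturbative crossover; no mass-gap claim».
Strong-coupling front of the two-front crossover ledger (IR-3 v2) for `SU(2)`, `d = 4`, Wilson action, `β_W = 4/g²`.
Elementary and kernel-checked; NOT a statement about Bałaban's renormalisation group, NOT the continuum, NOT Clay, NOT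
summit progress.  ABSOLUTE RULE: no internally-minted statement enters as a cited fact; nothing printed is used or cited
here — every statement is [folklore] real analysis about Mathlib's Haar probability measure on `SU(2)`.

WHAT THIS FILE DOES.  R20 (`Literature/…/Balaban1983to89/StrongCouplingVarianceWindow.lean`) proves
`Var_{ν_B}(w) ≤ ∫ w² dσ` for the one-link law `ν_B = σ.tilted (2 Re tr(· B))` and the linear observable
`w = 2 Re tr(· Δ)` as long as `|2 Re tr(g B)| ≤ 1` (`integral_var_tilted_le`).  Part 1 of J-SC11
(`StrongCouplingSixFifthsMoments`) extended the two one-dimensional moment inequalities behind it to tilts `κ ≤ 6/5`;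
this file repeats R20's isotropy argument (Part B.3) and variance lemma (Part B.4) VERBATIM with the range extended:
`integral_sq_sub_mul_exp_le_six_fifths`, `integral_var_tilted_le_six_fifths` (`|2 Re tr(g B)| ≤ 6/5`).  Part A re-proves
R20's file-private quaternion helpers (conjugations by `i, j, k, ω`, continuity of the coordinates, the rotation onto the
real axis), which are not importable.  Part 3 (`StrongCouplingSixFifthsWindow`) draws the consequences for the ledger:
the KR modulus `√(2c)` on `‖B‖_op ≤ 3/10` and the conditional doors up to `β_W < √3/9`.  No number of the cell's ledger
changes in this file.
-/

open MeasureTheory Filter Topology ProbabilityTheory Finset Real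
open scoped NNReal Quaternion
open Literature.Probability.LatticeModels
open Literature.MathematicalPhysics.QuantumLattice (fundamentalRep fundamentalLatticeRep quatMatrix su2Quat quatToSU2)
open Literature.MathematicalPhysics.QuantumFieldTheory
open Literature.MathematicalPhysics.QuantumFieldTheory.Balaban1983to89
open Literature.MathematicalPhysics.QuantumFieldTheory.Balaban1983to89.StrongCouplingDobrushinWindow
open Literature.MathematicalPhysics.QuantumFieldTheory.Balaban1983to89.StrongCouplingTorusWindow
open Literature.MathematicalPhysics.QuantumFieldTheory.Balaban1983to89.StrongCouplingKernelWindow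
open Literature.MathematicalPhysics.QuantumFieldTheory.Balaban1983to89.StrongCouplingOpenWindow
open Literature.MathematicalPhysics.QuantumFieldTheory.Balaban1983to89.StrongCouplingVarianceWindow
open Summit.QuantumFields.BalabanUV.InfraRed.StrongCouplingSixFifthsMoments

noncomputable section

namespace Summit.QuantumFields.BalabanUV.InfraRed.StrongCouplingSixFifthsVariance


/-! ## Part A: quaternion plumbing (R20's file-private helpers, re-proved; [folklore]) -/

section Plumbing

/-- `su2Quat (unitSU2 q) = q`. [folklore] -/
theorem su2Quat_unitSU2 (q : ℍ) (hq : ‖q‖ = 1) : su2Quat (unitSU2 q hq) = q := by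
  ext <;> rfl

/-- A quaternion with `re² + imI² + imJ² + imK² = 1` has norm `1`. [folklore] -/
theorem norm_eq_one_of_sq_sum {q : ℍ} (h : q.re ^ 2 + q.imI ^ 2 + q.imJ ^ 2 + q.imK ^ 2 = 1) : ‖q‖ = 1 := by
  have h1 : ‖q‖ * ‖q‖ = 1 := by
    rw [← Quaternion.normSq_eq_norm_mul_self, Quaternion.normSq_def']; exact h
  nlinarith [norm_nonneg q]

/-- Right translation only. [folklore] -/
theorem integral_comp_unit_right (Φ : ℍ → ℝ) {q : ℍ} (hq : ‖q‖ = 1) :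
    ∫ g, Φ (su2Quat g * q) ∂(haarProbability (Matrix.specialUnitaryGroup (Fin 2) ℂ)) = ∫ g, Φ (su2Quat g) ∂(haarProbability (Matrix.specialUnitaryGroup (Fin 2) ℂ)) := by
  have h := integral_comp_units Φ norm_one hq
  simpa only [one_mul] using h

/-- Conjugation by `i`: `(x₀, x₁, x₂, x₃) ↦ (x₀, x₁, −x₂, −x₃)`. [folklore] -/
theorem conj_qI (x : ℍ) : qI * x * star qI = ⟨x.re, x.imI, -x.imJ, -x.imK⟩ := by
  ext <;> simp only [qI, Quaternion.re_mul, Quaternion.imI_mul, Quaternion.imJ_mul, Quaternion.imK_mul, Quaternion.re_star, Quaternion.imI_star, Quaternion.imJ_star, Quaternion.imK_star] <;> ring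

/-- Conjugation by `j`: `(x₀, x₁, x₂, x₃) ↦ (x₀, −x₁, x₂, −x₃)`. [folklore] -/
theorem conj_qJ (x : ℍ) : qJ * x * star qJ = ⟨x.re, -x.imI, x.imJ, -x.imK⟩ := by
  ext <;> simp only [qJ, Quaternion.re_mul, Quaternion.imI_mul, Quaternion.imJ_mul, Quaternion.imK_mul, Quaternion.re_star, Quaternion.imI_star, Quaternion.imJ_star, Quaternion.imK_star] <;> ring

/-- Conjugation by `k`: `(x₀, x₁, x₂, x₃) ↦ (x₀, −x₁, −x₂, x₃)`. [folklore] -/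
theorem conj_qK (x : ℍ) : qK * x * star qK = ⟨x.re, -x.imI, -x.imJ, x.imK⟩ := by
  ext <;> simp only [qK, Quaternion.re_mul, Quaternion.imI_mul, Quaternion.imJ_mul, Quaternion.imK_mul, Quaternion.re_star, Quaternion.imI_star, Quaternion.imJ_star, Quaternion.imK_star] <;> ring


/-- Conjugation by `ω`: `(x₀, x₁, x₂, x₃) ↦ (x₀, x₃, x₁, x₂)`. [folklore] -/
theorem conj_qW (x : ℍ) : qW * x * star qW = ⟨x.re, x.imK, x.imI, x.imJ⟩ := by
  ext <;> simp only [qW, Quaternion.re_mul, Quaternion.imI_mul, Quaternion.imJ_mul, Quaternion.imK_mul, Quaternion.re_star, Quaternion.imI_star, Quaternion.imJ_star, Quaternion.imK_star] <;> ring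

/-- `su2Quat` as a linear combination of the constant quaternions `1, i, j, k`. [folklore] -/
theorem su2Quat_eq_sum (g : (Matrix.specialUnitaryGroup (Fin 2) ℂ)) :
    su2Quat g = (su2Quat g).re • (1 : ℍ) + (su2Quat g).imI • qI + (su2Quat g).imJ • qJ +
      (su2Quat g).imK • qK := by
  ext <;> simp [qI, qJ, qK]

/-- `su2Quat : SU(2) → ℍ` is continuous. [folklore] -/
private theorem continuous_su2Quat' : Continuous fun g : Matrix.specialUnitaryGroup (Fin 2) ℂ => su2Quat g := by
  have h00 : Continuous fun g : (Matrix.specialUnitaryGroup (Fin 2) ℂ) => (g : (Matrix (Fin 2) (Fin 2) ℂ)) 0 0 :=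
    (continuous_apply_apply 0 0).comp continuous_subtype_val
  have h01 : Continuous fun g : (Matrix.specialUnitaryGroup (Fin 2) ℂ) => (g : (Matrix (Fin 2) (Fin 2) ℂ)) 0 1 :=
    (continuous_apply_apply 0 1).comp continuous_subtype_val
  have hre : Continuous fun g : (Matrix.specialUnitaryGroup (Fin 2) ℂ) => (su2Quat g).re := Complex.continuous_re.comp h00
  have himI : Continuous fun g : (Matrix.specialUnitaryGroup (Fin 2) ℂ) => (su2Quat g).imI := Complex.continuous_im.comp h00
  have himJ : Continuous fun g : (Matrix.specialUnitaryGroup (Fin 2) ℂ) => (su2Quat g).imJ := Complex.continuous_re.comp h01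
  have himK : Continuous fun g : (Matrix.specialUnitaryGroup (Fin 2) ℂ) => (su2Quat g).imK := Complex.continuous_im.comp h01
  have : Continuous fun g : (Matrix.specialUnitaryGroup (Fin 2) ℂ) => (su2Quat g).re • (1 : ℍ) + (su2Quat g).imI • qI + (su2Quat g).imJ • qJ +
      (su2Quat g).imK • qK :=
    (((hre.smul continuous_const).add (himI.smul continuous_const)).add (himJ.smul continuous_const)).add
      (himK.smul continuous_const)
  refine this.congr fun g => (su2Quat_eq_sum g).symm

/-- Continuous functions of the coordinates are Haar integrable. [folklore] -/
theorem integrable_comp_su2Quat {Φ : ℍ → ℝ} (hΦ : Continuous Φ) : Integrable (fun g : (Matrix.specialUnitaryGroup (Fin 2) ℂ) => Φ (su2Quat g)) (haarProbability (Matrix.specialUnitaryGroup (Fin 2) ℂ)) :=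
  (hΦ.comp continuous_su2Quat').integrable_of_hasCompactSupport (HasCompactSupport.of_compactSpace _)

/-- A unit quaternion rotating `m` onto the positive real axis: `‖y‖ = 1`, `y · m = |m|`. [folklore] -/
theorem exists_unit_mul_eq_norm (m : ℍ) : ∃ y : ℍ, ‖y‖ = 1 ∧ y * m = ((‖m‖ : ℝ) : ℍ) := by
  by_cases hm : m = 0
  · exact ⟨1, norm_one, by simp [hm]⟩
  · have hn : ‖m‖ ≠ 0 := norm_ne_zero_iff.2 hm
    refine ⟨‖m‖⁻¹ • star m, ?_, ?_⟩
    · rw [norm_smul, norm_inv, norm_norm, Quaternion.norm_star, inv_mul_cancel₀ hn]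
    · rw [smul_mul_assoc, Quaternion.star_mul_self, Quaternion.normSq_eq_norm_mul_self, Quaternion.coe_mul,
        ← Quaternion.coe_mul_eq_smul, ← mul_assoc, ← Quaternion.coe_mul, inv_mul_cancel₀ hn, Quaternion.coe_one,
        one_mul]

/-- The potential is continuous. [folklore] -/
theorem continuous_pot (B : (Matrix (Fin 2) (Fin 2) ℂ)) : Continuous (pot B) := continuous_const.mul (continuous_re_trace_su_mul B)

/-- `|2 Re tr(g B)| ≤ 2√2 ‖B‖_F` (Cauchy–Schwarz, from the tree's `abs_re_trace_su2_mul_le_frob`). [folklore] -/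
theorem abs_pot_le (B : (Matrix (Fin 2) (Fin 2) ℂ)) (g : (Matrix.specialUnitaryGroup (Fin 2) ℂ)) : |pot B g| ≤ 2 * (Real.sqrt 2 * frobNorm B) := by
  simp only [pot]
  rw [abs_mul, abs_two]
  exact mul_le_mul_of_nonneg_left (abs_re_trace_su2_mul_le_frob g B) zero_le_two

end Plumbing

/-! ## Part B: isotropy and the variance lemma up to tilt `6/5` (R20 Parts B.3–B.4 verbatim, range extended) -/

section Variance

/-- **Isotropy + the two one-dimensional inequalities**: for `0 ≤ κ ≤ 6/5` and every quaternion `m`,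
`∫ (Re(x·m) − m₀ κ/4)² e^{κx₀} dσ ≤ (|m|²/4) ∫ e^{κx₀} dσ`.  The cross moments vanish (average over the
conjugations by `i, j, k`, which flip the signs of two of `x₁, x₂, x₃`), `∫ x₁² e = ∫ x₂² e = ∫ x₃² e = (1/3)∫(1 − x₀²) e`
(conjugation by `ω`), and part 1 (`StrongCouplingSixFifthsMoments`) bounds the two remaining one-dimensional integrals up to `κ = 6/5`.
(R20's `integral_sq_sub_mul_exp_le`, verbatim, with the range of `κ` extended.) [folklore] -/
theorem integral_sq_sub_mul_exp_le_six_fifths {κ : ℝ} (hκ0 : 0 ≤ κ) (hκ1 : κ ≤ 6 / 5) (m : ℍ) :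
    ∫ g, ((su2Quat g * m).re - m.re * κ / 4) ^ 2 * exp (κ * (su2Quat g).re) ∂(haarProbability (Matrix.specialUnitaryGroup (Fin 2) ℂ)) ≤
      Quaternion.normSq m / 4 * ∫ g, exp (κ * (su2Quat g).re) ∂(haarProbability (Matrix.specialUnitaryGroup (Fin 2) ℂ)) := by
  have hexpc : Continuous fun x : ℍ => exp (κ * x.re) := continuous_exp.comp (continuous_const.mul Quaternion.continuous_re)
  -- the integrand as a function on `ℍ`, and its continuity
  set ℓ : ℍ → ℝ := fun x => ((x * m).re - m.re * κ / 4) ^ 2 * exp (κ * x.re) with hℓ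
  have hℓc : Continuous ℓ :=
    (((Quaternion.continuous_re.comp (continuous_id.mul continuous_const)).sub continuous_const).pow 2).mul hexpc
  have hconjc : ∀ p q : ℍ, Continuous fun x : ℍ => p * x * q := fun p q =>
    (continuous_const.mul continuous_id).mul continuous_const
  -- the symmetrised integrand: cross terms cancel
  have hsym : ∀ x : ℍ, ℓ x + ℓ (qI * x * star qI) + ℓ (qJ * x * star qJ) + ℓ (qK * x * star qK) =
      4 * (m.re ^ 2 * ((x.re - κ / 4) ^ 2 * exp (κ * x.re))) + 4 * (m.imI ^ 2 * (x.imI ^ 2 * exp (κ * x.re))) +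
        4 * (m.imJ ^ 2 * (x.imJ ^ 2 * exp (κ * x.re))) + 4 * (m.imK ^ 2 * (x.imK ^ 2 * exp (κ * x.re))) := by
    intro x
    simp only [hℓ, conj_qI, conj_qJ, conj_qK, Quaternion.re_mul]
    ring
  have norm_qI : ‖qI‖ = 1 := norm_eq_one_of_sq_sum (by simp [qI])
  have norm_qJ : ‖qJ‖ = 1 := norm_eq_one_of_sq_sum (by simp [qJ])
  have norm_qK : ‖qK‖ = 1 := norm_eq_one_of_sq_sum (by simp [qK])
  have norm_qW : ‖qW‖ = 1 := norm_eq_one_of_sq_sum (by simp [qW]; norm_num)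
  have hstI : ‖star qI‖ = 1 := by rw [norm_star]; exact norm_qI
  have hstJ : ‖star qJ‖ = 1 := by rw [norm_star]; exact norm_qJ
  have hstK : ‖star qK‖ = 1 := by rw [norm_star]; exact norm_qK
  have hstW : ‖star qW‖ = 1 := by rw [norm_star]; exact norm_qW
  have hI := integral_comp_units ℓ norm_qI hstI
  have hJ := integral_comp_units ℓ norm_qJ hstJ
  have hK := integral_comp_units ℓ norm_qK hstK
  have iℓ : Integrable (fun g : (Matrix.specialUnitaryGroup (Fin 2) ℂ) => ℓ (su2Quat g)) (haarProbability (Matrix.specialUnitaryGroup (Fin 2) ℂ)) := integrable_comp_su2Quat hℓc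
  have iℓI : Integrable (fun g : (Matrix.specialUnitaryGroup (Fin 2) ℂ) => ℓ (qI * su2Quat g * star qI)) (haarProbability (Matrix.specialUnitaryGroup (Fin 2) ℂ)) :=
    integrable_comp_su2Quat (Φ := fun x => ℓ (qI * x * star qI)) (hℓc.comp (hconjc _ _))
  have iℓJ : Integrable (fun g : (Matrix.specialUnitaryGroup (Fin 2) ℂ) => ℓ (qJ * su2Quat g * star qJ)) (haarProbability (Matrix.specialUnitaryGroup (Fin 2) ℂ)) :=
    integrable_comp_su2Quat (Φ := fun x => ℓ (qJ * x * star qJ)) (hℓc.comp (hconjc _ _))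
  have iℓK : Integrable (fun g : (Matrix.specialUnitaryGroup (Fin 2) ℂ) => ℓ (qK * su2Quat g * star qK)) (haarProbability (Matrix.specialUnitaryGroup (Fin 2) ℂ)) :=
    integrable_comp_su2Quat (Φ := fun x => ℓ (qK * x * star qK)) (hℓc.comp (hconjc _ _))
  -- the four even moments
  have iA : Integrable (fun g : (Matrix.specialUnitaryGroup (Fin 2) ℂ) => ((su2Quat g).re - κ / 4) ^ 2 * exp (κ * (su2Quat g).re)) (haarProbability (Matrix.specialUnitaryGroup (Fin 2) ℂ)) :=
    integrable_comp_su2Quat (Φ := fun x => (x.re - κ / 4) ^ 2 * exp (κ * x.re))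
      (((Quaternion.continuous_re.sub continuous_const).pow 2).mul hexpc)
  have iV1 : Integrable (fun g : (Matrix.specialUnitaryGroup (Fin 2) ℂ) => (su2Quat g).imI ^ 2 * exp (κ * (su2Quat g).re)) (haarProbability (Matrix.specialUnitaryGroup (Fin 2) ℂ)) :=
    integrable_comp_su2Quat (Φ := fun x => x.imI ^ 2 * exp (κ * x.re)) ((Quaternion.continuous_imI.pow 2).mul hexpc)
  have iV2 : Integrable (fun g : (Matrix.specialUnitaryGroup (Fin 2) ℂ) => (su2Quat g).imJ ^ 2 * exp (κ * (su2Quat g).re)) (haarProbability (Matrix.specialUnitaryGroup (Fin 2) ℂ)) :=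
    integrable_comp_su2Quat (Φ := fun x => x.imJ ^ 2 * exp (κ * x.re)) ((Quaternion.continuous_imJ.pow 2).mul hexpc)
  have iV3 : Integrable (fun g : (Matrix.specialUnitaryGroup (Fin 2) ℂ) => (su2Quat g).imK ^ 2 * exp (κ * (su2Quat g).re)) (haarProbability (Matrix.specialUnitaryGroup (Fin 2) ℂ)) :=
    integrable_comp_su2Quat (Φ := fun x => x.imK ^ 2 * exp (κ * x.re)) ((Quaternion.continuous_imK.pow 2).mul hexpc)
  set Z : ℝ := ∫ g, exp (κ * (su2Quat g).re) ∂(haarProbability (Matrix.specialUnitaryGroup (Fin 2) ℂ)) with hZ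
  set A : ℝ := ∫ g, ((su2Quat g).re - κ / 4) ^ 2 * exp (κ * (su2Quat g).re) ∂(haarProbability (Matrix.specialUnitaryGroup (Fin 2) ℂ)) with hA
  set U : ℝ := ∫ g, (su2Quat g).re ^ 2 * exp (κ * (su2Quat g).re) ∂(haarProbability (Matrix.specialUnitaryGroup (Fin 2) ℂ)) with hU
  set V1 : ℝ := ∫ g, (su2Quat g).imI ^ 2 * exp (κ * (su2Quat g).re) ∂(haarProbability (Matrix.specialUnitaryGroup (Fin 2) ℂ)) with hV1
  set V2 : ℝ := ∫ g, (su2Quat g).imJ ^ 2 * exp (κ * (su2Quat g).re) ∂(haarProbability (Matrix.specialUnitaryGroup (Fin 2) ℂ)) with hV2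
  set V3 : ℝ := ∫ g, (su2Quat g).imK ^ 2 * exp (κ * (su2Quat g).re) ∂(haarProbability (Matrix.specialUnitaryGroup (Fin 2) ℂ)) with hV3
  -- `4 ∫ ℓ = 4 (m₀² A + m₁² V1 + m₂² V2 + m₃² V3)`
  have h4 : 4 * ∫ g, ℓ (su2Quat g) ∂(haarProbability (Matrix.specialUnitaryGroup (Fin 2) ℂ)) = 4 * (m.re ^ 2 * A) + 4 * (m.imI ^ 2 * V1) + 4 * (m.imJ ^ 2 * V2) +
      4 * (m.imK ^ 2 * V3) := by
    have j1 : Integrable (fun g : (Matrix.specialUnitaryGroup (Fin 2) ℂ) => ℓ (su2Quat g) + ℓ (qI * su2Quat g * star qI)) (haarProbability (Matrix.specialUnitaryGroup (Fin 2) ℂ)) := iℓ.add iℓI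
    have j2 : Integrable (fun g : (Matrix.specialUnitaryGroup (Fin 2) ℂ) => ℓ (su2Quat g) + ℓ (qI * su2Quat g * star qI) + ℓ (qJ * su2Quat g * star qJ)) (haarProbability (Matrix.specialUnitaryGroup (Fin 2) ℂ)) :=
      j1.add iℓJ
    have hs : ∫ g, (ℓ (su2Quat g) + ℓ (qI * su2Quat g * star qI) + ℓ (qJ * su2Quat g * star qJ) +
        ℓ (qK * su2Quat g * star qK)) ∂(haarProbability (Matrix.specialUnitaryGroup (Fin 2) ℂ)) = 4 * ∫ g, ℓ (su2Quat g) ∂(haarProbability (Matrix.specialUnitaryGroup (Fin 2) ℂ)) := by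
      rw [integral_add j2 iℓK, integral_add j1 iℓJ, integral_add iℓ iℓI, hI, hJ, hK]
      ring
    rw [← hs]
    simp_rw [hsym]
    have k1 : Integrable (fun g : (Matrix.specialUnitaryGroup (Fin 2) ℂ) => 4 * (m.re ^ 2 * (((su2Quat g).re - κ / 4) ^ 2 * exp (κ * (su2Quat g).re)))) (haarProbability (Matrix.specialUnitaryGroup (Fin 2) ℂ)) :=
      (iA.const_mul _).const_mul _
    have k2 : Integrable (fun g : (Matrix.specialUnitaryGroup (Fin 2) ℂ) => 4 * (m.imI ^ 2 * ((su2Quat g).imI ^ 2 * exp (κ * (su2Quat g).re)))) (haarProbability (Matrix.specialUnitaryGroup (Fin 2) ℂ)) :=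
      (iV1.const_mul _).const_mul _
    have k3 : Integrable (fun g : (Matrix.specialUnitaryGroup (Fin 2) ℂ) => 4 * (m.imJ ^ 2 * ((su2Quat g).imJ ^ 2 * exp (κ * (su2Quat g).re)))) (haarProbability (Matrix.specialUnitaryGroup (Fin 2) ℂ)) :=
      (iV2.const_mul _).const_mul _
    have k4 : Integrable (fun g : (Matrix.specialUnitaryGroup (Fin 2) ℂ) => 4 * (m.imK ^ 2 * ((su2Quat g).imK ^ 2 * exp (κ * (su2Quat g).re)))) (haarProbability (Matrix.specialUnitaryGroup (Fin 2) ℂ)) :=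
      (iV3.const_mul _).const_mul _
    have l1 : Integrable (fun g : (Matrix.specialUnitaryGroup (Fin 2) ℂ) => 4 * (m.re ^ 2 * (((su2Quat g).re - κ / 4) ^ 2 * exp (κ * (su2Quat g).re))) +
        4 * (m.imI ^ 2 * ((su2Quat g).imI ^ 2 * exp (κ * (su2Quat g).re)))) (haarProbability (Matrix.specialUnitaryGroup (Fin 2) ℂ)) := k1.add k2
    have l2 : Integrable (fun g : (Matrix.specialUnitaryGroup (Fin 2) ℂ) => 4 * (m.re ^ 2 * (((su2Quat g).re - κ / 4) ^ 2 * exp (κ * (su2Quat g).re))) +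
        4 * (m.imI ^ 2 * ((su2Quat g).imI ^ 2 * exp (κ * (su2Quat g).re))) +
        4 * (m.imJ ^ 2 * ((su2Quat g).imJ ^ 2 * exp (κ * (su2Quat g).re)))) (haarProbability (Matrix.specialUnitaryGroup (Fin 2) ℂ)) := l1.add k3
    rw [integral_add l2 k4, integral_add l1 k3, integral_add k1 k2, integral_const_mul, integral_const_mul,
      integral_const_mul, integral_const_mul, integral_const_mul, integral_const_mul, integral_const_mul,
      integral_const_mul]
  -- isotropy: `V2 = V1`, `V3 = V1`
  have eV2 : V1 = V2 := by
    have h := integral_comp_units (fun x : ℍ => x.imJ ^ 2 * exp (κ * x.re)) norm_qW hstW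
    simp only [conj_qW] at h
    exact h
  have eV3 : V3 = V1 := by
    have h := integral_comp_units (fun x : ℍ => x.imI ^ 2 * exp (κ * x.re)) norm_qW hstW
    simp only [conj_qW] at h
    exact h
  -- the sphere: `U + V1 + V2 + V3 = Z`
  have iU : Integrable (fun g : (Matrix.specialUnitaryGroup (Fin 2) ℂ) => (su2Quat g).re ^ 2 * exp (κ * (su2Quat g).re)) (haarProbability (Matrix.specialUnitaryGroup (Fin 2) ℂ)) :=
    integrable_comp_su2Quat (Φ := fun x => x.re ^ 2 * exp (κ * x.re)) ((Quaternion.continuous_re.pow 2).mul hexpc)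
  have hsphere : U + V1 + V2 + V3 = Z := by
    have m1 : Integrable (fun g : (Matrix.specialUnitaryGroup (Fin 2) ℂ) => (su2Quat g).re ^ 2 * exp (κ * (su2Quat g).re) +
        (su2Quat g).imI ^ 2 * exp (κ * (su2Quat g).re)) (haarProbability (Matrix.specialUnitaryGroup (Fin 2) ℂ)) := iU.add iV1
    have m2 : Integrable (fun g : (Matrix.specialUnitaryGroup (Fin 2) ℂ) => (su2Quat g).re ^ 2 * exp (κ * (su2Quat g).re) +
        (su2Quat g).imI ^ 2 * exp (κ * (su2Quat g).re) + (su2Quat g).imJ ^ 2 * exp (κ * (su2Quat g).re)) (haarProbability (Matrix.specialUnitaryGroup (Fin 2) ℂ)) := m1.add iV2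
    rw [hU, hV1, hV2, hV3, hZ, ← integral_add iU iV1, ← integral_add m1 iV2,
      ← integral_add m2 iV3]
    refine integral_congr_ae (ae_of_all _ fun g => ?_)
    have h1 := sq_sum_su2Quat g
    simp only
    linear_combination exp (κ * (su2Quat g).re) * h1
  -- the two one-dimensional inequalities
  have hAle : A ≤ 1 / 4 * Z := integral_shift_sq_mul_exp_le_six_fifths hκ0 hκ1
  have hUge : 1 / 4 * Z ≤ U := quarter_integral_exp_le_six_fifths hκ0 hκ1
  have hZ0 : 0 ≤ Z := integral_nonneg fun g => (exp_pos _).le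
  -- assemble
  have hV1le : V1 ≤ Z / 4 := by linarith
  have hnormSq : Quaternion.normSq m = m.re ^ 2 + m.imI ^ 2 + m.imJ ^ 2 + m.imK ^ 2 := Quaternion.normSq_def' m
  show ∫ g, ℓ (su2Quat g) ∂(haarProbability (Matrix.specialUnitaryGroup (Fin 2) ℂ)) ≤ Quaternion.normSq m / 4 * Z
  rw [hnormSq]
  nlinarith [sq_nonneg m.re, sq_nonneg m.imI, sq_nonneg m.imJ, sq_nonneg m.imK, eV2, eV3]


/-- **The variance lemma.**  For the one-link law `ν_B = σ.tilted (2 Re tr(· B))` of `SU(2)` with `|2 Re tr(g B)| ≤ 6/5`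
for all `g`, and the linear observable `w = 2 Re tr(· Δ)`:  `Var_{ν_B}(w) ≤ ∫ w² dσ` (`= Var_σ(w)`, `w` having Haar
mean zero).  Axis reduction by a right translation (Creutz (18.17)), isotropy of the transverse coordinates, and the
two one-dimensional inequalities of part 1 (R20's `integral_var_tilted_le`, verbatim, with `|2 Re tr(g B)| ≤ 6/5`). [folklore] -/
theorem integral_var_tilted_le_six_fifths (B Δ : (Matrix (Fin 2) (Fin 2) ℂ)) (hB : ∀ g : (Matrix.specialUnitaryGroup (Fin 2) ℂ), |pot B g| ≤ 6 / 5) :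
    ∫ s, (pot Δ s - ∫ s', pot Δ s' ∂(Measure.tilted (haarProbability (Matrix.specialUnitaryGroup (Fin 2) ℂ)) (pot B))) ^ 2 ∂(Measure.tilted (haarProbability (Matrix.specialUnitaryGroup (Fin 2) ℂ)) (pot B)) ≤
      ∫ s, pot Δ s ^ 2 ∂(haarProbability (Matrix.specialUnitaryGroup (Fin 2) ℂ)) := by
  obtain ⟨y, hy1, hy⟩ := exists_unit_mul_eq_norm (qp B)
  set κ : ℝ := 4 * ‖qp B‖ with hκ
  have hκ0 : 0 ≤ κ := by positivity
  -- `κ = F(y) ≤ 6/5`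
  have hκ1 : κ ≤ 6 / 5 := by
    have h := hB (unitSU2 y hy1)
    rw [pot_eq, su2Quat_unitSU2, hy, Quaternion.re_coe] at h
    exact (le_abs_self _).trans h
  set m' : ℍ := y * qp Δ with hm'
  have hnm' : Quaternion.normSq m' = Quaternion.normSq (qp Δ) := by
    rw [hm', map_mul, Quaternion.normSq_eq_norm_mul_self y, hy1, one_mul, one_mul]
  set a : ℝ := m'.re * κ with ha
  set ν : Measure (Matrix.specialUnitaryGroup (Fin 2) ℂ) := Measure.tilted (haarProbability (Matrix.specialUnitaryGroup (Fin 2) ℂ)) (pot B) with hν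
  -- integrability and the normalisation
  have hFm : Measurable (pot B) := (continuous_pot B).measurable
  have hwm : Measurable (pot Δ) := (continuous_pot Δ).measurable
  have hexpF : Integrable (fun s => exp (pot B s)) (haarProbability (Matrix.specialUnitaryGroup (Fin 2) ℂ)) :=
    integrable_of_measurable_of_abs_le hFm.exp (C := exp (6 / 5)) fun s => by
      rw [abs_of_nonneg (exp_pos _).le]; exact exp_le_exp.2 ((le_abs_self _).trans (hB s))
  haveI : IsProbabilityMeasure ν := isProbabilityMeasure_tilted hexpF
  set Z : ℝ := ∫ s, exp (pot B s) ∂(haarProbability (Matrix.specialUnitaryGroup (Fin 2) ℂ)) with hZ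
  have hZpos : 0 < Z := by
    rw [hZ]; exact integral_exp_pos hexpF
  -- Step 1: `Var_ν(w) ≤ E_ν (w − a)²`
  have hXb : ∃ C, ∀ s, |pot Δ s - a| ≤ C := ⟨2 * (Real.sqrt 2 * frobNorm Δ) + |a|, fun s =>
    (abs_sub _ _).trans (add_le_add (abs_pot_le Δ s) le_rfl)⟩
  have h1 : ∫ s, (pot Δ s - ∫ s', pot Δ s' ∂ν) ^ 2 ∂ν ≤ ∫ s, (pot Δ s - a) ^ 2 ∂ν := by
    have h := integral_sub_avg_sq_le (μ := ν) (hwm.sub_const a) hXb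
    have hwi : Integrable (pot Δ) ν := integrable_of_measurable_of_abs_le hwm (abs_pot_le Δ)
    have hmean : ∫ s', (pot Δ s' - a) ∂ν = (∫ s', pot Δ s' ∂ν) - a := by
      rw [integral_sub hwi (integrable_const a), integral_const]; simp
    rw [hmean] at h
    have he : ∀ s, pot Δ s - a - ((∫ s', pot Δ s' ∂ν) - a) = pot Δ s - ∫ s', pot Δ s' ∂ν := fun s => by ring
    simp_rw [he] at h
    exact h
  -- Step 2: the tilted integral as a Haar integral
  have h2 : ∫ s, (pot Δ s - a) ^ 2 ∂ν = (∫ s, exp (pot B s) * (pot Δ s - a) ^ 2 ∂(haarProbability (Matrix.specialUnitaryGroup (Fin 2) ℂ))) / Z := by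
    rw [hν, integral_tilted]
    simp_rw [smul_eq_mul, div_mul_eq_mul_div]
    exact integral_div _ _
  -- Step 3: axis reduction by the right translation `x ↦ x · y`
  have hre : ∀ x : ℍ, (x * y * qp B).re = x.re * ‖qp B‖ := fun x => by
    rw [mul_assoc, hy, Quaternion.re_mul]
    simp
  have hexp : ∀ x : ℍ, exp (4 * (x.re * ‖qp B‖)) = exp (κ * x.re) := fun x => by
    rw [hκ]; ring_nf
  have h3 : ∫ s, exp (pot B s) * (pot Δ s - a) ^ 2 ∂(haarProbability (Matrix.specialUnitaryGroup (Fin 2) ℂ)) =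
      16 * ∫ g, ((su2Quat g * m').re - m'.re * κ / 4) ^ 2 * exp (κ * (su2Quat g).re) ∂(haarProbability (Matrix.specialUnitaryGroup (Fin 2) ℂ)) := by
    have h := integral_comp_unit_right (fun x : ℍ => exp (4 * (x * qp B).re) * (4 * (x * qp Δ).re - a) ^ 2) hy1
    have hl : ∀ g : (Matrix.specialUnitaryGroup (Fin 2) ℂ), exp (4 * (su2Quat g * y * qp B).re) * (4 * (su2Quat g * y * qp Δ).re - a) ^ 2 =
        16 * (((su2Quat g * m').re - m'.re * κ / 4) ^ 2 * exp (κ * (su2Quat g).re)) := fun g => by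
      have e1 : (su2Quat g * y * qp Δ).re = (su2Quat g * m').re := by rw [hm', mul_assoc]
      rw [hre, hexp, e1, ha]
      ring
    simp only [hl] at h
    rw [integral_const_mul] at h
    simp only [pot_eq]
    exact h.symm
  have hZ' : Z = ∫ g, exp (κ * (su2Quat g).re) ∂(haarProbability (Matrix.specialUnitaryGroup (Fin 2) ℂ)) := by
    have h := integral_comp_unit_right (fun x : ℍ => exp (4 * (x * qp B).re)) hy1
    simp only [hre, hexp] at h
    rw [hZ]
    simp only [pot_eq]
    exact h.symm
  -- Step 4: the core inequality
  have h4 := integral_sq_sub_mul_exp_le_six_fifths hκ0 hκ1 m'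
  rw [← hZ', hnm'] at h4
  -- Step 5: assemble
  have hw2 : ∫ s, pot Δ s ^ 2 ∂(haarProbability (Matrix.specialUnitaryGroup (Fin 2) ℂ)) = 4 * Quaternion.normSq (qp Δ) := integral_sq_two_mul_re_trace Δ
  rw [hw2]
  refine h1.trans ?_
  rw [h2, h3, div_le_iff₀ hZpos]
  nlinarith [h4, hZpos.le]

end Variance

end Summit.QuantumFields.BalabanUV.InfraRed.StrongCouplingSixFifthsVariance

end
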